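import Summits.KontsevichZagierPeriods.KontsevichZagierPeriods.Theorems.SoloInformedBandLeaf
import HarnessLib

/-!
# The slab lemma: presentability on a vertical slab cut by one cell branch

Solo programme `solo-KontsevichZagierPeriods-informed`, session s110, PRES-RAT(2) step (β)-4.

Let `γ` be a cell branch, `Ω` an open `ℚ`-semialgebraic set whose frontier inside the open unit
square lies on `Z(γ.H)` (= the graph of `a = Re γ.A`), and `N/D` a `K`-rational function with `D ≠ 0`
on the closed square.  On a `K`-slab `(α, α + β) × (0, 1)` over which the branch satisfies the
TRICHOTOMY (inside `(0,1)` throughout, or `≤ 0` throughout, or `≥ 1` throughout), `N/D` is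
presentable on `Ω ∩ slab` (`SoloInformedCellBranch.presOn_inter_slab`):

* inside: `Ω ∩ slab` is, up to the null graph, the union of `Ω ∩ (upper band)` and
  `Ω ∩ (lower band)`, and each band lies in `Ω` or misses it (LOCAL SIDE dichotomy), so each piece
  is a BAND LEAF or empty;
* outside: the frontier of `Ω` misses the slab, so the (convex) slab lies in `Ω` or misses it:
  SLAB LEAF or empty.

Also: two-piece union rules for `SoloInformedPresOn`.

References: M. Kontsevich, D. Zagier, *Periods* (2001) §1.2.
-/

noncomputable section

open scoped BigOperators Topology
open MeasureTheory Set Metric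
open Literature.NumberTheory.Transcendental Literature.NumberTheory.Transcendental.KZ
open Literature.ModelTheory.ExponentialFields (IsSemialgebraic)

namespace Summit.KontsevichZagierPeriods.KontsevichZagierPeriods.Theorems

variable {n : ℕ} {K : Type*} [Field K] [Algebra K ℝ]

/-! ### Two-piece rules -/

/-- **Rule (1) for two pieces.** [Kontsevich–Zagier 2001 §1.2 rule (1)] -/
theorem soloInformed_presOn_union {Ω A B : Set (Fin n → ℝ)} {f : (Fin n → ℝ) → ℝ}
    (hA : IsSemialgebraic ℚ A) (hB : IsSemialgebraic ℚ B) (hAB : volume (A ∩ B) = 0)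
    (hΩ : Ω = A ∪ B) (ha : SoloInformedPresOn A f) (hb : SoloInformedPresOn B f) :
    SoloInformedPresOn Ω f := by
  refine soloInformed_presOn_of_iUnion (fun b : Bool => bif b then A else B)
    (fun b => by cases b <;> assumption) (fun i j hij => ?_) ?_ fun b => by cases b <;> assumption
  · cases i <;> cases j
    · exact absurd rfl hij
    · simpa only [cond_false, cond_true, inter_comm] using hAB
    · simpa only [cond_false, cond_true] using hAB
    · exact absurd rfl hij
  · rw [hΩ]
    ext x
    simp only [mem_union, mem_iUnion]
    constructor
    · rintro (h | h)
      · exact ⟨true, h⟩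
      · exact ⟨false, h⟩
    · rintro ⟨b, hb⟩
      cases b
      · exact Or.inr hb
      · exact Or.inl hb

/-- **Two pieces up to a null set.**  If `A, B ⊆ Ω` are `ℚ`-semialgebraic with null overlap,
`Ω ∖ (A ∪ B)` is null and `f` is presentable on `A` and on `B`, then `f` is presentable on `Ω`.
[Kontsevich–Zagier 2001 §1.2 rule (1)] -/
theorem soloInformed_presOn_of_union_null {Ω A B : Set (Fin n → ℝ)} {f : (Fin n → ℝ) → ℝ}
    (hA : IsSemialgebraic ℚ A) (hB : IsSemialgebraic ℚ B) (hAB : volume (A ∩ B) = 0)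
    (hAΩ : A ⊆ Ω) (hBΩ : B ⊆ Ω) (hnull : volume (Ω \ (A ∪ B)) = 0)
    (ha : SoloInformedPresOn A f) (hb : SoloInformedPresOn B f) : SoloInformedPresOn Ω f :=
  soloInformed_presOn_of_subset_null (hA.union hB) (union_subset hAΩ hBΩ) hnull
    (soloInformed_presOn_union hA hB hAB rfl ha hb)

/-- If `A ⊆ Ω` or `A` misses `Ω`, presentability on `A` gives presentability on `Ω ∩ A`. -/
theorem soloInformed_presOn_inter_of_subset_or_disjoint {Ω A : Set (Fin n → ℝ)}
    {f : (Fin n → ℝ) → ℝ} (h : A ⊆ Ω ∨ Disjoint A Ω) (hA : SoloInformedPresOn A f) :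
    SoloInformedPresOn (Ω ∩ A) f := by
  rcases h with h | h
  · rwa [inter_eq_right.2 h]
  · rw [Set.disjoint_iff_inter_eq_empty, inter_comm] at h
    rw [h]
    exact soloInformed_presOn_empty f

/-! ### Slabs in two variables -/

/-- In two variables the slab `{α < x₀ < α + β} ∩ (0,1)²` with `[α, α + β] ⊆ [0,1]` is the box
`(α, α + β) × (0, 1)`. -/
theorem soloInformed_box2_eq_slabR {α β : ℝ} (hα : 0 ≤ α) (hαβ : α + β ≤ 1) :
    soloInformedBox2 α (α + β) 0 1 = soloInformedSlabR 0 α β := by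
  ext z
  simp only [soloInformedBox2, soloInformedSlabR, mem_setOf_eq, soloInformed_mem_openCube_iff,
    Fin.forall_fin_two]
  constructor
  · rintro ⟨⟨h1, h2⟩, h3, h4⟩
    exact ⟨⟨⟨by linarith, by linarith⟩, h3, h4⟩, h1, h2⟩
  · rintro ⟨⟨-, h3, h4⟩, h1, h2⟩
    exact ⟨⟨h1, h2⟩, h3, h4⟩

/-- The box `(u, v) × (0, 1)` is the rectangle of `SoloInformedShearDiv`. -/
theorem soloInformed_box2_eq_rect (u v : ℝ) : soloInformedBox2 u v 0 1 = soloInformedRect u v :=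
  rfl

namespace SoloInformedCellBranch

section Slab

variable [CharZero K] (γ : SoloInformedCellBranch K)
  (hK : ∀ c : K, IsAlgebraic ℚ (algebraMap K ℝ c)) (hKrc : SoloInformedRealRootClosed K)
  (a0 b0 : K) (hα : 0 ≤ algebraMap K ℝ a0) (hβ : 0 < algebraMap K ℝ b0)
  (hαβ : algebraMap K ℝ a0 + algebraMap K ℝ b0 ≤ 1)
  (N D : MvPolynomial (Fin 2) K) (hD : ∀ y ∈ soloInformedCube 2, (MvPolynomial.aeval y D : ℝ) ≠ 0)
  {Ω : Set (Fin 2 → ℝ)} (hΩo : IsOpen Ω) (hΩ : IsSemialgebraic ℚ Ω)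
  (hfr : ∀ z ∈ soloInformedOpenCube 2, z ∈ frontier Ω → (MvPolynomial.aeval z γ.H : ℝ) = 0)

omit [CharZero K] in
include hα hαβ hfr in
/-- Inside the slab, frontier points of `Ω` lie on the graph of `a`. -/
theorem frontier_on_graph :
    ∀ z ∈ soloInformedBox2 (algebraMap K ℝ a0) (algebraMap K ℝ a0 + algebraMap K ℝ b0) 0 1,
      z ∈ frontier Ω → z 1 = γ.a (z 0) := by
  intro z hz hzf
  rw [soloInformed_box2_eq_slabR hα hαβ] at hz
  exact (γ.aeval_eq_zero_iff' (soloInformedOpenCube_subset_cube 2 hz.1)).1 (hfr z hz.1 hzf)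

include hK hα hβ hαβ hD hΩo hΩ hfr in
/-- **SLAB LEMMA, branch inside.**  If the branch stays inside `(0,1)` over `(α, α + β)`, then
`N/D` is presentable on `Ω ∩ slab`. [this work] -/
theorem presOn_inter_slab_inside
    (hin : ∀ s : ℝ, algebraMap K ℝ a0 < s → s < algebraMap K ℝ a0 + algebraMap K ℝ b0 →
      0 < γ.a s ∧ γ.a s < 1) :
    SoloInformedPresOn (Ω ∩ soloInformedSlabR 0 (algebraMap K ℝ a0) (algebraMap K ℝ b0))
      (fun y => (MvPolynomial.aeval y N : ℝ) / MvPolynomial.aeval y D) := by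
  set α : ℝ := algebraMap K ℝ a0 with hαd
  set β : ℝ := algebraMap K ℝ b0 with hβd
  have hbox := soloInformed_box2_eq_slabR hα hαβ
  have hIcc : Ioo α (α + β) ⊆ Icc (0 : ℝ) 1 := fun s hs => ⟨by linarith [hs.1], by linarith [hs.2]⟩
  have hin' : ∀ s : ℝ, 0 < s → s < 1 → 0 < γ.a (α + β * s) ∧ γ.a (α + β * s) < 1 :=
    fun s hs0 hs1 => hin _ (by nlinarith) (by nlinarith)
  have hfr' := γ.frontier_on_graph a0 b0 hα hαβ hfr
  have hca : ContinuousOn γ.a (Ioo α (α + β)) := γ.continuousOn_a.mono hIcc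
  have hslabK := isSemialgebraic_soloInformedSlabK hK (n := 2) 0 a0 b0
  have hslabc : soloInformedSlabR 0 α β ⊆ soloInformedCube 2 :=
    fun z hz => soloInformedOpenCube_subset_cube 2 hz.1
  -- the two pieces
  set A := soloInformedBox2Above γ.a α (α + β) 0 1 with hAd
  set B := soloInformedBox2Below γ.a α (α + β) 0 1 with hBd
  have hAsa : IsSemialgebraic ℚ A := by
    show IsSemialgebraic ℚ {z | z ∈ soloInformedBox2 α (α + β) 0 1 ∧ γ.a (z 0) < z 1}
    rw [hbox]
    exact γ.isSemialgebraic_above hK hslabK hslabc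
  have hBsa : IsSemialgebraic ℚ B := by
    show IsSemialgebraic ℚ {z | z ∈ soloInformedBox2 α (α + β) 0 1 ∧ z 1 < γ.a (z 0)}
    rw [hbox]
    exact γ.isSemialgebraic_below hK hslabK hslabc
  have hA : SoloInformedPresOn (Ω ∩ A) (fun y => (MvPolynomial.aeval y N : ℝ) / MvPolynomial.aeval y D) :=
    soloInformed_presOn_inter_of_subset_or_disjoint
      (soloInformed_box2Above_subset_or_disjoint hΩo hca hin hfr')
      (γ.presOn_upper hK a0 b0 hα hβ hαβ hin' N D hD)
  have hB : SoloInformedPresOn (Ω ∩ B) (fun y => (MvPolynomial.aeval y N : ℝ) / MvPolynomial.aeval y D) :=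
    soloInformed_presOn_inter_of_subset_or_disjoint
      (soloInformed_box2Below_subset_or_disjoint hΩo hca hin hfr')
      (γ.presOn_lower hK a0 b0 hα hβ hαβ hin' N D hD)
  refine soloInformed_presOn_of_union_null (hΩ.inter hAsa) (hΩ.inter hBsa) ?_
    (inter_subset_inter_right Ω fun z hz => by rw [← hbox]; exact hz.1)
    (inter_subset_inter_right Ω fun z hz => by rw [← hbox]; exact hz.1) ?_ hA hB
  · exact measure_mono_null (fun z hz => (lt_asymm hz.1.2.2 hz.2.2.2).elim) measure_empty
  · refine measure_mono_null (fun z hz => ?_) (soloInformed_volume_zeroSet_openCube γ.H_ne)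
    obtain ⟨⟨hzΩ, hzs⟩, hzn⟩ := hz
    have hzb : z ∈ soloInformedBox2 α (α + β) 0 1 := by rw [hbox]; exact hzs
    refine ⟨hzs.1, (γ.aeval_eq_zero_iff' (hslabc hzs)).2 ?_⟩
    rcases lt_trichotomy (z 1) (γ.a (z 0)) with hlt | heq | hgt
    · exact absurd (Or.inr ⟨hzΩ, hzb, hlt⟩ : z ∈ Ω ∩ A ∪ Ω ∩ B) hzn
    · exact heq
    · exact absurd (Or.inl ⟨hzΩ, hzb, hgt⟩ : z ∈ Ω ∩ A ∪ Ω ∩ B) hzn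

include hK hKrc hα hβ hαβ hΩo hfr in
/-- **SLAB LEMMA, branch outside.**  If the branch stays `≤ 0` or `≥ 1` over `(α, α + β)`, then
the frontier of `Ω` misses the slab, so `Ω ∩ slab` is the slab or empty: `N/D` is presentable on
it. [this work] -/
theorem presOn_inter_slab_outside
    (hout : (∀ s : ℝ, algebraMap K ℝ a0 < s → s < algebraMap K ℝ a0 + algebraMap K ℝ b0 →
        γ.a s ≤ 0) ∨
      (∀ s : ℝ, algebraMap K ℝ a0 < s → s < algebraMap K ℝ a0 + algebraMap K ℝ b0 → 1 ≤ γ.a s)) :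
    SoloInformedPresOn (Ω ∩ soloInformedSlabR 0 (algebraMap K ℝ a0) (algebraMap K ℝ b0))
      (fun y => (MvPolynomial.aeval y N : ℝ) / MvPolynomial.aeval y D) := by
  set α : ℝ := algebraMap K ℝ a0 with hαd
  set β : ℝ := algebraMap K ℝ b0 with hβd
  have hbox := soloInformed_box2_eq_slabR hα hαβ
  have hfr' := γ.frontier_on_graph a0 b0 hα hαβ hfr
  have hdisj : Disjoint (soloInformedSlabR (n := 2) 0 α β) (frontier Ω) := by
    refine Set.disjoint_left.2 fun z hz hzf => ?_
    have hzb : z ∈ soloInformedBox2 α (α + β) 0 1 := by rw [hbox]; exact hz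
    have h1 := hfr' z hzb hzf
    obtain ⟨⟨hz1, hz2⟩, hz3, hz4⟩ := hzb
    rcases hout with h | h
    · have := h (z 0) hz1 hz2
      linarith
    · have := h (z 0) hz1 hz2
      linarith
  have hpre : IsPreconnected (soloInformedSlabR (n := 2) 0 α β) := by
    rw [← hbox, soloInformed_box2_eq_rect]
    exact (soloInformed_convex_rect α (α + β)).isPreconnected
  exact soloInformed_presOn_inter_of_subset_or_disjoint
    (soloInformed_subset_or_disjoint_of_frontier hpre hΩo hdisj)
    (soloInformed_presOn_slabK_rational_dim2 hK hKrc 0 a0 b0 hα hβ hαβ N D)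

include hK hKrc hα hβ hαβ hD hΩo hΩ hfr in
/-- **SLAB LEMMA.**  Under the trichotomy for the branch over `(α, α + β)`, `N/D` is presentable
on `Ω ∩ slab`. [this work] -/
theorem presOn_inter_slab
    (htri : (∀ s : ℝ, algebraMap K ℝ a0 < s → s < algebraMap K ℝ a0 + algebraMap K ℝ b0 →
        0 < γ.a s ∧ γ.a s < 1) ∨
      (∀ s : ℝ, algebraMap K ℝ a0 < s → s < algebraMap K ℝ a0 + algebraMap K ℝ b0 → γ.a s ≤ 0) ∨
      (∀ s : ℝ, algebraMap K ℝ a0 < s → s < algebraMap K ℝ a0 + algebraMap K ℝ b0 → 1 ≤ γ.a s)) :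
    SoloInformedPresOn (Ω ∩ soloInformedSlabR 0 (algebraMap K ℝ a0) (algebraMap K ℝ b0))
      (fun y => (MvPolynomial.aeval y N : ℝ) / MvPolynomial.aeval y D) := by
  rcases htri with h | h
  · exact γ.presOn_inter_slab_inside hK a0 b0 hα hβ hαβ N D hD hΩo hΩ hfr h
  · exact γ.presOn_inter_slab_outside hK hKrc a0 b0 hα hβ hαβ N D hΩo hfr h

end Slab

end SoloInformedCellBranch

end Summit.KontsevichZagierPeriods.KontsevichZagierPeriods.Theorems
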